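import Summits.BirchSwinnertonDyer.BirchSwinnertonDyer.Theorems.ManinLocalTwoThreeTameThreeIstarSuccLines
import HarnessLib

/-!
# On tame `Iₙ*` (`n ≥ 1`) at `3`, a rational `3`-line with `ord₃ D₀ = 0` has Néron scalar `u = 3` (E-an-109, potentially multiplicative stratum)

Summit `BirchSwinnertonDyer`, route `ManinLocalTwoThree` (cell bsd-f2-manin), deciding crux C3 `ManinPrimeToThreeAtNine`
(stmt-BirchSwinnertonDyer-22968).  Sequel of `…TameThreeIstarSuccLines` (`veluD₀_dichotomy_of_IstarSucc_three`: on `Iₙ₊₁*`, `ord₃ D₀ = 0 ∧ (A = 0 ∨ ord₃ A ≥ 6)`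
or `ord₃ D₀ ≥ 3`), with the additivity transfer p654741/p654521 and the exact `Iₙ*` `j`-valuation p651737:

* `kodairaSymbolAt_Istar_of_additive_of_le` — an additive curve at `3` with `ord₃ Δ_min ≥ 14` is `I*_{ord₃Δ_min − 6}` with `ord₃ j = 6 − ord₃ Δ_min`
  (`f₃ ≤ 5` ⟹ `m ≥ 10` ⟹ `Iₙ*`, tame, `f = 2`);
* `IstarSucc_velu_three_of_D₀_unit` — **`9 ∣ N`, type `Iₙ₊₁*`, `ord₃ D₀ = 0` ⟹ `u = 3`**: an ISOGENOUS globally minimal curve carries `(3⁻⁴A, 3⁻⁶B)`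
  and no isogenous one carries `(A, B)` (it would be additive with `ord₃ Δ_min = 3n + 24`, i.e. `I*_{3n+18}` with `ord₃ j = −(3n + 18)`, against
  `j = A³/Δ` with `ord₃ A ≥ 6` or `A = 0`).  Unconditional.

HONEST FRAMING: the branch `ord₃ D₀ ≥ 3` on `Iₙ*` is left open; C3, Manin's conjecture and BSD are not proved.  No definitions, no named facts, no
sorry.  References: [SilvermanATAEC1994] IV.9.4 Step 7, IV.10.4, Table 4.1; [BrumerKramer1994] Thm. 6.2; [DokchitserDokchitser2015LocalInvariants] Table 1.
-/

set_option linter.dupNamespace false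
set_option autoImplicit false

noncomputable section

open scoped Classical

open WeierstrassCurve IsDedekindDomain IsLocalRing Polynomial NumberField Rat.HeightOneSpectrum CongruenceSubgroup
  Literature.NumberTheory.DiophantineGeometry Literature.NumberTheory.DiophantineGeometry.TateAlgorithm
  Literature.NumberTheory.EllipticCurves Literature.NumberTheory.EllipticCurves.ModularForms
  Summit.BirchSwinnertonDyer.Rank1Residual.Additive

namespace Summit.BirchSwinnertonDyer.BirchSwinnertonDyer.Theorems.ManinLocalTwoThree

/-- **An additive curve at `3` with `ord₃ Δ_min ≥ 14` is of type `I*_{ord₃Δ_min − 6}` and has `ord₃ j = 6 − ord₃ Δ_min`** (`f₃ ≤ 5` ⟹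
`m ≥ 10` ⟹ `Iₙ*`; `Iₙ*` is tame, `f = 2`). [cite: SilvermanATAEC1994, IV.10.4 and Table 4.1] [cite: BrumerKramer1994, Thm. 6.2] -/
theorem kodairaSymbolAt_Istar_of_additive_of_le (W : WeierstrassCurve ℚ) [W.IsElliptic] [W.IsGloballyMinimal]
    (ha : W.HasAdditiveReductionAt (placeOf 3)) (hΔ : 14 ≤ padicValInt 3 W.minimalDiscriminantInt) :
    ∃ m : ℕ, W.kodairaSymbolAt (placeOf 3) = .Istar (m + 1) ∧ padicValInt 3 W.minimalDiscriminantInt = m + 7 ∧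
      padicValRat 3 W.j = -((m : ℤ) + 1) := by
  haveI : PerfectField (IsLocalRing.ResidueField ((placeOf 3).adicCompletionIntegers ℚ)) := PerfectField.ofFinite
  have hgen : natGenerator (placeOf 3) = 3 :=
    congrArg Subtype.val ((primesEquiv (R := ℤ)).apply_symm_apply ⟨3, Nat.prime_three⟩)
  have hf5 : W.conductorExponent (placeOf 3) ≤ 5 := W.conductorExponent_le_five_of_natGenerator_eq_three_holds (placeOf 3) hgen
  have hadd : (W.kodairaSymbolAt (placeOf 3)).IsAdditive := (isAdditive_kodairaSymbolAt_iff_holds (placeOf 3) W).mpr ha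
  have hδ : W.ordMinimalDiscriminant (placeOf 3) = padicValInt 3 W.minimalDiscriminantInt := ordMinimalDiscriminant_placeOf_eq W 3
  have h2 : ringChar (ℤ ⧸ (placeOf 3).asIdeal) ≠ 2 := by rw [ringChar_int_quot_placeOf 3]; decide
  have hIstar : ∃ m, W.kodairaSymbolAt (placeOf 3) = .Istar (m + 1) := by
    have hf := hf5
    unfold conductorExponent numComponentsAt at hf
    rw [hδ] at hf
    generalize hT : W.kodairaSymbolAt (placeOf 3) = T at hadd hf
    cases T with
    | I k => exact absurd hadd (KodairaSymbol.not_isAdditive_I k)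
    | II => rw [show KodairaSymbol.numComponents .II = 1 from rfl] at hf; omega
    | III => rw [show KodairaSymbol.numComponents .III = 2 from rfl] at hf; omega
    | IV => rw [show KodairaSymbol.numComponents .IV = 3 from rfl] at hf; omega
    | Istar k =>
      cases k with
      | zero => rw [KodairaSymbol.numComponents_Istar] at hf; omega
      | succ k => exact ⟨k, rfl⟩
    | IVstar => rw [show KodairaSymbol.numComponents .IVstar = 7 from rfl] at hf; omega
    | IIIstar => rw [show KodairaSymbol.numComponents .IIIstar = 8 from rfl] at hf; omega
    | IIstar => rw [show KodairaSymbol.numComponents .IIstar = 9 from rfl] at hf; omega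
  obtain ⟨m, hm⟩ := hIstar
  have hf2 : W.conductorExponent (placeOf 3) = 2 :=
    W.conductorExponent_eq_two_of_kodairaSymbolAt (placeOf 3) h2 (Or.inr (Or.inr ⟨m + 1, hm⟩))
  have hδm : padicValInt 3 W.minimalDiscriminantInt = m + 7 := by
    unfold conductorExponent numComponentsAt at hf2
    rw [hδ, hm, KodairaSymbol.numComponents_Istar] at hf2
    omega
  exact ⟨m, hm, hδm, padicValRat_three_j_eq_neg_of_kodairaSymbolAt_Istar_succ W hm⟩

/-- **On tame `Iₙ₊₁*`, a rational `3`-line with `ord₃ D₀ = 0` has Néron scalar `u = 3`:** an ISOGENOUS globally minimal curve carries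
`(3⁻⁴A, 3⁻⁶B)`, none carries `(A, B)` (such a carrier would be additive with `ord₃ Δ_min = 3n + 24`, of type `I*_{3n+18}` with
`ord₃ j = −(3n + 18)`, against `j = A³/Δ` with `ord₃ A ≥ 6` or `A = 0`).  Unconditional.
[cite: SilvermanATAEC1994, IV.9.4 Table 4.1] [cite: DokchitserDokchitser2015LocalInvariants, Table 1] -/
theorem IstarSucc_velu_three_of_D₀_unit (W : WeierstrassCurve ℚ) [W.IsElliptic] [W.IsGloballyMinimal] {n : ℕ}
    (h9 : 3 ^ 2 ∣ W.conductorNorm ℤ) (hK : W.kodairaSymbolAt (placeOf 3) = .Istar (n + 1)) (q : ℚ) (hq : W.Ψ₃.eval (q - W.b₂ / 12) = 0)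
    (hD0 : padicValRat 3 (W.Ψ₂Sq.eval (q - W.b₂ / 12)) = 0) :
    (∃ (W' : WeierstrassCurve ℚ) (_ : W'.IsElliptic) (_ : W'.IsGloballyMinimal), IsIsogenous W W' ∧
        (3 : ℚ) ^ 4 * W'.c₄ = 1440 * q ^ 2 - 9 * W.c₄ ∧
        (3 : ℚ) ^ 6 * W'.c₆ = 60480 * q ^ 3 - 756 * W.c₄ * q - 27 * W.c₆) ∧
      ¬ ∃ (W' : WeierstrassCurve ℚ) (_ : W'.IsElliptic) (_ : W'.IsGloballyMinimal), IsIsogenous W W' ∧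
        W'.c₄ = 1440 * q ^ 2 - 9 * W.c₄ ∧ W'.c₆ = 60480 * q ^ 3 - 756 * W.c₄ * q - 27 * W.c₆ := by
  haveI : Fact (Nat.Prime 3) := ⟨Nat.prime_three⟩
  haveI : PerfectField (IsLocalRing.ResidueField ((placeOf 3).adicCompletionIntegers ℚ)) := PerfectField.ofFinite
  have haW := hasAdditiveReductionAt_placeOf_three_of_nine_dvd W h9
  -- `ord₃ Δ_min(W) = n + 7`
  have h2 : ringChar (ℤ ⧸ (placeOf 3).asIdeal) ≠ 2 := by rw [ringChar_int_quot_placeOf 3]; decide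
  have hδ : padicValInt 3 W.minimalDiscriminantInt = n + 7 := by
    have h := W.ordMinimalDiscriminant_eq_numComponentsAt_add_one_of_kodairaSymbolAt (placeOf 3) h2 (Or.inr (Or.inr ⟨n + 1, hK⟩))
    unfold numComponentsAt at h
    rw [hK, KodairaSymbol.numComponents_Istar, ordMinimalDiscriminant_placeOf_eq W 3] at h
    omega
  have hA : 1440 * q ^ 2 - 9 * W.c₄ = 0 ∨ 6 ≤ padicValRat 3 (1440 * q ^ 2 - 9 * W.c₄) := by
    rcases veluD₀_dichotomy_of_IstarSucc_three W hK q hq with ⟨-, hA⟩ | hD3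
    · exact hA
    · omega
  have hnoMin : ¬ ∃ (W' : WeierstrassCurve ℚ) (_ : W'.IsElliptic) (_ : W'.IsGloballyMinimal), IsIsogenous W W' ∧
      W'.c₄ = 1440 * q ^ 2 - 9 * W.c₄ ∧ W'.c₆ = 60480 * q ^ 3 - 756 * W.c₄ * q - 27 * W.c₆ := by
    rintro ⟨W', hE', hM', hiso, hc4, hc6⟩
    have hb := padicValRat_velu_three_Δ 3 W q hq W' hc4 hc6
    rw [hD0, ← cast_minimalDiscriminantInt W', ← cast_minimalDiscriminantInt W, padicValRat.of_int, padicValRat.of_int, hδ] at hb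
    push_cast at hb
    have hδ' : (padicValInt 3 W'.minimalDiscriminantInt : ℤ) = 3 * n + 21 := by omega
    obtain ⟨m, -, hm7, hj⟩ := kodairaSymbolAt_Istar_of_additive_of_le W'
      (hasAdditiveReductionAt_placeOf_three_of_isIsogenous haW hiso) (by omega)
    rcases hA with hA0 | hA6
    · have hj0 : W'.j = 0 := by rw [WeierstrassCurve.j, hc4, hA0]; ring
      rw [hj0, padicValRat.zero] at hj
      omega
    · have hc₄ne : W'.c₄ ≠ 0 := by
        intro h0; rw [← hc4, h0, padicValRat.zero] at hA6; norm_num at hA6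
      have hj' := padicValRat_three_j_eq W' hc₄ne
      rw [hc4, ← cast_minimalDiscriminantInt W', padicValRat.of_int] at hj'
      rw [hj'] at hj
      omega
  refine ⟨?_, hnoMin⟩
  obtain ⟨W', k, hE', hM', hiso, hk, hk0, h4', h6', -⟩ := exists_isIsogenous_dvd_three_velu_three W q hq
  haveI := hE'; haveI := hM'
  rcases eq_or_eq_of_int_dvd_three hk with hk1 | hk3
  · exfalso
    have hk4 : (k : ℚ) ^ 4 = 1 := by rcases hk1 with rfl | rfl <;> norm_num
    have hk6 : (k : ℚ) ^ 6 = 1 := by rcases hk1 with rfl | rfl <;> norm_num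
    rw [hk4, one_mul] at h4'
    rw [hk6, one_mul] at h6'
    exact hnoMin ⟨W', hE', hM', hiso, h4', h6'⟩
  · have hk4 : (k : ℚ) ^ 4 = 3 ^ 4 := by rcases hk3 with rfl | rfl <;> norm_num
    have hk6 : (k : ℚ) ^ 6 = 3 ^ 6 := by rcases hk3 with rfl | rfl <;> norm_num
    rw [hk4] at h4'
    rw [hk6] at h6'
    exact ⟨W', hE', hM', hiso, h4', h6'⟩

end Summit.BirchSwinnertonDyer.BirchSwinnertonDyer.Theorems.ManinLocalTwoThree

end
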